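import Summits.HodgeConjecture.HodgeConjecture.Theorems.Ring2WeilCoverageCMFieldAllPrimes
import HarnessLib

/-!
# Weil-type components over quartic CM fields, IX (part C): ALL PRIMES for the cyclic field `ℚ(√-(2+√2)) ⊂ ℚ(ζ₁₆)`
# and the non-Galois field `ℚ(√-(3+√2))` (`D₄`)

research route conditional on HC_CM; not a corollary; Q11.4-sentence-2 already refuted in dim ≥ 3. Cell
`pub-hodge-ring2`, seat `ring2-b03` (gen 51); continuation of parts A/B (`Ring2WeilCoverageCMFieldAllPrimes`, `…B`),
kernel form of the INDEX SET of the Weil-type family-coverage census `HOME/WEIL-FAMILY-COVERAGE.md` §b03 with a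
VARIABLE prime `ℓ` (`ℓ ∤ w` throughout), for the two census fields over `F = ℚ(√2)` that are not biquadratic:

* `E = ℚ(√-(2+√2))` (`R = S² + 4S + 2`, `σ = -√2(1+√2)`, cyclic quartic of conductor `16`): `[ℓw] ≠ [1]` for every
  prime `ℓ ≡ ±3 (mod 8)` (`ℓ` INERT in `F` and `(ℓ)` inert in `E/F`: `2 = Nm σ` a non-square — these primes are
  inert in `E`) and for every prime `ℓ ≡ 9 (mod 16)` (`ℓ` SPLIT in `F`, both places inert in `E/F`: a square root of
  `σ ↦ ±r - 2`, `r² = 2`, together with `√-2 ∈ 𝔽_ℓ` would give a primitive 16th root of unity in `𝔽_ℓ`, part A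
  `sixteen_dvd_sub_one_of_sq_eq_sqrt_two_sub_two`). Density `1/2 + 1/8`; the remaining obstructed class
  `ℓ ≡ 15 (mod 16)` (e.g. the census row `[31]`, gen 47 by numerals) is a genuinely quartic condition whose variable-`ℓ`
  form needs `𝔽_{ℓ²}` and is not treated here.
* `E = ℚ(√-(3+√2))` (`R = S² + 6S + 7`, `Nm σ = 7`, non-Galois with Galois closure `D₄`, `h(E) = 2`): `[ℓw] ≠ [1]`
  for every prime `ℓ ≡ ±3 (mod 8)` with `7` a non-square mod `ℓ`, i.e. `ℓ mod 56 ∈ {5, 11, 13, 43, 45, 51}`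
  (reciprocity for `7`; `ℓ` inert in `F`, `(ℓ)` inert in `E/F`) — density `1/4`. (The other obstructed primes of this
  field — one place split and one inert over `ℓ ≡ ±1 (mod 8)`, gens 48/50 — need a prime-dependent degree-one `π`
  and stay numeral-by-numeral.)

Part D: pairwise distinctness of the classes `[ℓ]` and INFINITELY MANY non-split components per field. No named
fact, no definition, no `sorry`; nothing about the Hodge conjecture is asserted (Deligne Cor. 4.2 / Landherr decide
which component is the split one; the general member of every row is OPEN, census §b03.2).
References: [Deligne1982HodgeCycles] §4 p. 30 (1), Cor. 4.2, Lemma 4.6; [Landherr1936HermitianForms]. -/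

noncomputable section

set_option linter.dupNamespace false

open Polynomial

namespace Summit.HodgeConjecture.HodgeConjecture.Ring2.WeilCoverageCM

open Literature.AlgebraicGeometry.Deligne1982
open Literature.AlgebraicGeometry.HodgeTheory (splitDiscriminantClassCM)

/-! ### §0 `7` as a non-residue from `ℓ mod 56` (reciprocity) -/

/-- `7` is a NON-square mod a prime `ℓ ≡ ±3 (mod 8)` in the classes `ℓ mod 56 ∈ {5, 11, 13, 43, 45, 51}`: for
`ℓ ≡ 5 (mod 8)` (`ℓ ≡ 1 (4)`) `(7/ℓ) = (ℓ/7)` and `ℓ ≡ 3, 5, 6 (mod 7)` are the non-residues; for `ℓ ≡ 3 (mod 8)`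
(`ℓ ≡ 3 (4)`, `7 ≡ 3 (4)`) `(7/ℓ) = -(ℓ/7)` and `ℓ ≡ 1, 2, 4 (mod 7)` are the residues. [folklore] -/
theorem not_isSquare_seven_of_mod_fiftySix {ℓ : ℕ} [Fact ℓ.Prime]
    (h56 : ℓ % 56 = 5 ∨ ℓ % 56 = 11 ∨ ℓ % 56 = 13 ∨ ℓ % 56 = 43 ∨ ℓ % 56 = 45 ∨ ℓ % 56 = 51) :
    ¬ IsSquare (7 : ZMod ℓ) := by
  -- residue facts mod 7 as closed terms
  have n3 : ¬ IsSquare ((3 : ℕ) : ZMod 7) := by decide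
  have n5 : ¬ IsSquare ((5 : ℕ) : ZMod 7) := by decide
  have n6 : ¬ IsSquare ((6 : ℕ) : ZMod 7) := by decide
  have y1 : IsSquare ((1 : ℕ) : ZMod 7) := by decide
  have y2 : IsSquare ((2 : ℕ) : ZMod 7) := by decide
  have y4 : IsSquare ((4 : ℕ) : ZMod 7) := by decide
  haveI : Fact (Nat.Prime 7) := ⟨by norm_num⟩
  have hℓ7 : ℓ ≠ 7 := by omega
  intro h
  have h' : IsSquare ((7 : ℕ) : ZMod ℓ) := by exact_mod_cast h
  rcases h56 with h | h | h | h | h | h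
  · -- ℓ ≡ 5 (8), ℓ ≡ 5 (7)
    have key := (ZMod.exists_sq_eq_prime_iff_of_mod_four_eq_one (p := ℓ) (q := 7) (by omega) (by norm_num)).1 h'
    rw [← ZMod.natCast_mod ℓ 7, show ℓ % 7 = 5 by omega] at key; exact n5 key
  · -- ℓ ≡ 3 (8), ℓ ≡ 4 (7)
    have key := (ZMod.exists_sq_eq_prime_iff_of_mod_four_eq_three (p := ℓ) (q := 7) (by omega) (by norm_num) hℓ7).1 h'
    rw [← ZMod.natCast_mod ℓ 7, show ℓ % 7 = 4 by omega] at key; exact key y4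
  · -- ℓ ≡ 5 (8), ℓ ≡ 6 (7)
    have key := (ZMod.exists_sq_eq_prime_iff_of_mod_four_eq_one (p := ℓ) (q := 7) (by omega) (by norm_num)).1 h'
    rw [← ZMod.natCast_mod ℓ 7, show ℓ % 7 = 6 by omega] at key; exact n6 key
  · -- ℓ ≡ 3 (8), ℓ ≡ 1 (7)
    have key := (ZMod.exists_sq_eq_prime_iff_of_mod_four_eq_three (p := ℓ) (q := 7) (by omega) (by norm_num) hℓ7).1 h'
    rw [← ZMod.natCast_mod ℓ 7, show ℓ % 7 = 1 by omega] at key; exact key y1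
  · -- ℓ ≡ 5 (8), ℓ ≡ 3 (7)
    have key := (ZMod.exists_sq_eq_prime_iff_of_mod_four_eq_one (p := ℓ) (q := 7) (by omega) (by norm_num)).1 h'
    rw [← ZMod.natCast_mod ℓ 7, show ℓ % 7 = 3 by omega] at key; exact n3 key
  · -- ℓ ≡ 3 (8), ℓ ≡ 2 (7)
    have key := (ZMod.exists_sq_eq_prime_iff_of_mod_four_eq_three (p := ℓ) (q := 7) (by omega) (by norm_num) hℓ7).1 h'
    rw [← ZMod.natCast_mod ℓ 7, show ℓ % 7 = 2 by omega] at key; exact key y2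

/-! ### §1 `E = ℚ(√-(2+√2))`: `R = S² + 4S + 2`, `F = ℚ(√2)` — every prime `ℓ ≡ ±3 (mod 8)` and every prime
`ℓ ≡ 9 (mod 16)` -/

section SqrtNegTwoPlusSqrtTwo

variable {R : Polynomial ℤ} (hR : R = X ^ 2 + C 4 * X + C 2) [Fact (Irreducible (realPolyQ R))]
include hR

/-- **`[ℓw] ≠ [1]` for `E = ℚ(√-(2+√2))` and EVERY prime `ℓ ≡ ±3 (mod 8)`, `ℓ ∤ w`**: `2` is a non-square mod `ℓ`
(Mathlib `ZMod.exists_sq_eq_two_iff`), so `R = (S+2)² - 2` has no root (`ℓ` INERT in `F = ℚ(√2)`) and `Nm σ = 2` is a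
non-square (`(ℓ)` inert in `E/F`): the generic inert criterion gives NON-SPLIT components `W8.E.[ℓw]` (census rows
`[3], [5], [11], [13], [19], [29], [37], …` at once). [cite: Deligne1982HodgeCycles, §4 p. 30 (1) and Cor. 4.2]
[cite: Landherr1936HermitianForms] -/
theorem sqrtNegTwoPlusSqrtTwo_mk_prime_mul_ne_splitDiscriminantClassCM_of_mod_eight (ℓ : ℕ) (hℓ : ℓ.Prime)
    (h8 : ℓ % 8 = 3 ∨ ℓ % 8 = 5) (w : ℤ) (hw : ¬ (ℓ : ℤ) ∣ w) (u : (realField R)ˣ)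
    (hu : (u : realField R) = AdjoinRoot.of (realPolyQ R) (ℓ * w)) :
    (QuotientGroup.mk u : cmNormResidueGroup R) ≠ splitDiscriminantClassCM R 2 := by
  haveI : Fact ℓ.Prime := ⟨hℓ⟩
  have h2 : ℓ ≠ 2 := by omega
  have hns2 : ¬ IsSquare (2 : ZMod ℓ) := by rw [ZMod.exists_sq_eq_two_iff h2]; omega
  refine mk_prime_mul_ne_splitDiscriminantClassCM_of_no_root hR (by norm_num) (by norm_num) disc_not_sq_four_two
    ℓ hℓ ?_ ?_ w hw u hu
  · intro k hk
    push_cast at hk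
    exact hns2 ⟨k + 2, by linear_combination (-1 : ZMod ℓ) * hk⟩
  · push_cast
    exact forall_sq_ne_of_not_isSquare hns2

/-- **`[ℓw] ≠ [1]` for `E = ℚ(√-(2+√2))` and EVERY prime `ℓ ≡ 9 (mod 16)`, `ℓ ∤ w`**: `ℓ` SPLITS in `F = ℚ(√2)`
(`2 = r²` mod `ℓ`; places `σ ↦ ±r - 2`) and both places are INERT in `E/F`: `ℓ ≡ 1 (mod 8)` gives `√-2 ∈ 𝔽_ℓ`, and
then a square root of `±r - 2` would be a primitive 16th root of unity in `𝔽_ℓ`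
(`sixteen_dvd_sub_one_of_sq_eq_sqrt_two_sub_two`), i.e. `ℓ ≡ 1 (mod 16)` — excluded. So the split criterion gives
NON-SPLIT components `W8.E.[ℓw]` (rows `[41], [73], [89], …`; in the census window `S6 ∋ (41, √2-17)`).
[cite: Deligne1982HodgeCycles, §4 p. 30 (1) and Cor. 4.2] [cite: Landherr1936HermitianForms] -/
theorem sqrtNegTwoPlusSqrtTwo_mk_prime_mul_ne_splitDiscriminantClassCM_of_mod_sixteen (ℓ : ℕ) (hℓ : ℓ.Prime)
    (h16 : ℓ % 16 = 9) (w : ℤ) (hw : ¬ (ℓ : ℤ) ∣ w) (u : (realField R)ˣ)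
    (hu : (u : realField R) = AdjoinRoot.of (realPolyQ R) (ℓ * w)) :
    (QuotientGroup.mk u : cmNormResidueGroup R) ≠ splitDiscriminantClassCM R 2 := by
  haveI : Fact ℓ.Prime := ⟨hℓ⟩
  have h2 : ℓ ≠ 2 := by omega
  have h2' : (2 : ZMod ℓ) ≠ 0 := by exact_mod_cast natCast_prime_ne_zero_zmod Nat.prime_two h2
  obtain ⟨r, hr⟩ := (ZMod.exists_sq_eq_two_iff h2).2 (Or.inl (by omega))
  obtain ⟨s, hs⟩ := (ZMod.exists_sq_eq_neg_two_iff h2).2 (Or.inl (by omega))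
  have hr' : r ^ 2 = 2 := by rw [sq, ← hr]
  have hr'' : (-r) ^ 2 = 2 := by rw [neg_sq, hr']
  have hs' : s ^ 2 = -2 := by rw [sq, ← hs]
  have hno : ∀ t : ZMod ℓ, t ^ 2 = 2 → ∀ x : ZMod ℓ, x ^ 2 ≠ -2 + t := by
    intro t ht x hx
    have := sixteen_dvd_sub_one_of_sq_eq_sqrt_two_sub_two h2 t s x ht hs' (by rw [hx]; ring)
    omega
  refine mk_prime_mul_ne_splitDiscriminantClassCM_of_two_roots hR (by norm_num) (by norm_num) disc_not_sq_four_two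
    ℓ hℓ (-2 + r) (-2 + -r) (by push_cast; linear_combination hr') (by push_cast; linear_combination hr') ?_
    (hno r hr') (hno (-r) hr'') w hw u hu
  intro h
  have hr0 : r = 0 := eq_zero_of_const_mul_eq_zero h2' (by linear_combination h)
  rw [hr0, mul_zero] at hr
  exact h2' hr

/-- **`[ℓ] ≠ [1]` for `E = ℚ(√-(2+√2))` and every prime `ℓ ≡ 3, 5 (mod 8)` or `ℓ ≡ 9 (mod 16)`.**
[cite: Deligne1982HodgeCycles, §4 p. 30 (1) and Cor. 4.2] -/
theorem sqrtNegTwoPlusSqrtTwo_mk_prime_ne_splitDiscriminantClassCM_of_mod (ℓ : ℕ) (hℓ : ℓ.Prime)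
    (h : ℓ % 8 = 3 ∨ ℓ % 8 = 5 ∨ ℓ % 16 = 9) (u : (realField R)ˣ) (hu : (u : realField R) = ℓ) :
    (QuotientGroup.mk u : cmNormResidueGroup R) ≠ splitDiscriminantClassCM R 2 := by
  have hu' : (u : realField R) = AdjoinRoot.of (realPolyQ R) (ℓ * (1 : ℤ)) := by
    rw [hu, Int.cast_one, mul_one]; exact (map_natCast (AdjoinRoot.of (realPolyQ R)) ℓ).symm
  have h1 : ¬ (ℓ : ℤ) ∣ 1 := by exact_mod_cast hℓ.not_dvd_one
  rcases h with h | h | h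
  · exact sqrtNegTwoPlusSqrtTwo_mk_prime_mul_ne_splitDiscriminantClassCM_of_mod_eight hR ℓ hℓ (Or.inl h) 1 h1 u hu'
  · exact sqrtNegTwoPlusSqrtTwo_mk_prime_mul_ne_splitDiscriminantClassCM_of_mod_eight hR ℓ hℓ (Or.inr h) 1 h1 u hu'
  · exact sqrtNegTwoPlusSqrtTwo_mk_prime_mul_ne_splitDiscriminantClassCM_of_mod_sixteen hR ℓ hℓ h 1 h1 u hu'

end SqrtNegTwoPlusSqrtTwo

/-! ### §2 `E = ℚ(√-(3+√2))` (`D₄`): `R = S² + 6S + 7`, `F = ℚ(√2)` — every prime `ℓ ≡ ±3 (mod 8)` with `(7/ℓ) = -1` -/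

section SqrtNegThreePlusSqrtTwo

variable {R : Polynomial ℤ} (hR : R = X ^ 2 + C 6 * X + C 7) [Fact (Irreducible (realPolyQ R))]
include hR

/-- **`[ℓw] ≠ [1]` for the non-Galois field `E = ℚ(√-(3+√2))` and EVERY prime `ℓ mod 56 ∈ {5, 11, 13, 43, 45, 51}`,
`ℓ ∤ w`**: `ℓ ≡ ±3 (mod 8)` makes `2` a non-square, so `R = (S+3)² - 2` has no root (`ℓ` INERT in `F = ℚ(√2)`), and
`Nm σ = 7` is a non-square mod `ℓ` (reciprocity, `not_isSquare_seven_of_mod_fiftySix`), so `(ℓ)` is inert in `E/F`: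
NON-SPLIT components `W8.E.[ℓw]` (census rows `[5], [11], [13], [43w], …` at once; the first variable-prime theorem
for a non-Galois CM field in the tree). [cite: Deligne1982HodgeCycles, §4 p. 30 (1) and Cor. 4.2]
[cite: Landherr1936HermitianForms] -/
theorem sqrtNegThreePlusSqrtTwo_mk_prime_mul_ne_splitDiscriminantClassCM_of_mod_fiftySix (ℓ : ℕ) (hℓ : ℓ.Prime)
    (h56 : ℓ % 56 = 5 ∨ ℓ % 56 = 11 ∨ ℓ % 56 = 13 ∨ ℓ % 56 = 43 ∨ ℓ % 56 = 45 ∨ ℓ % 56 = 51)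
    (w : ℤ) (hw : ¬ (ℓ : ℤ) ∣ w) (u : (realField R)ˣ)
    (hu : (u : realField R) = AdjoinRoot.of (realPolyQ R) (ℓ * w)) :
    (QuotientGroup.mk u : cmNormResidueGroup R) ≠ splitDiscriminantClassCM R 2 := by
  haveI : Fact ℓ.Prime := ⟨hℓ⟩
  have h2 : ℓ ≠ 2 := by omega
  have hns2 : ¬ IsSquare (2 : ZMod ℓ) := by rw [ZMod.exists_sq_eq_two_iff h2]; omega
  have hns7 : ¬ IsSquare (7 : ZMod ℓ) := not_isSquare_seven_of_mod_fiftySix h56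
  refine mk_prime_mul_ne_splitDiscriminantClassCM_of_no_root hR (by norm_num) (by norm_num) disc_not_sq_six_seven
    ℓ hℓ ?_ ?_ w hw u hu
  · intro k hk
    push_cast at hk
    exact hns2 ⟨k + 3, by linear_combination (-1 : ZMod ℓ) * hk⟩
  · push_cast
    exact forall_sq_ne_of_not_isSquare hns7

/-- **`[ℓ] ≠ [1]` for `E = ℚ(√-(3+√2))` and every prime `ℓ mod 56 ∈ {5, 11, 13, 43, 45, 51}`.**
[cite: Deligne1982HodgeCycles, §4 p. 30 (1) and Cor. 4.2] -/
theorem sqrtNegThreePlusSqrtTwo_mk_prime_ne_splitDiscriminantClassCM_of_mod_fiftySix (ℓ : ℕ) (hℓ : ℓ.Prime)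
    (h56 : ℓ % 56 = 5 ∨ ℓ % 56 = 11 ∨ ℓ % 56 = 13 ∨ ℓ % 56 = 43 ∨ ℓ % 56 = 45 ∨ ℓ % 56 = 51)
    (u : (realField R)ˣ) (hu : (u : realField R) = ℓ) :
    (QuotientGroup.mk u : cmNormResidueGroup R) ≠ splitDiscriminantClassCM R 2 :=
  sqrtNegThreePlusSqrtTwo_mk_prime_mul_ne_splitDiscriminantClassCM_of_mod_fiftySix hR ℓ hℓ h56 1
    (by exact_mod_cast hℓ.not_dvd_one) u
    (by rw [hu, Int.cast_one, mul_one]; exact (map_natCast (AdjoinRoot.of (realPolyQ R)) ℓ).symm)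

end SqrtNegThreePlusSqrtTwo

end Summit.HodgeConjecture.HodgeConjecture.Ring2.WeilCoverageCM

end
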